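import Mathlib.Algebra.BigOperators.Fin
import Mathlib.Tactic.Ring
import Literature.Computability.Complexity.Circuit
import Literature.Computability.AlgebraicComplexity.CircuitGateSemantics
import Literature.Computability.AlgebraicComplexity.DepthReductionProofs
import HarnessLib

/-!
# Helpers for stub `stub_dictionary` (line `Sketch`, crux `CircuitNpTc0`, stmt-PneNP-0039):
# arithmetic gate lists and the `¬/∧/∨` blocks of the threshold dictionary

Generic facts about the tree's straight-line arithmetic circuits (`ArithCircuit`: total left
folds `gateValues` / `gateWDepths`, Bürgisser 2000, Def. 2.1; product-depth weight `prodWeight`)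
used by the cube-exact translation of threshold circuits
(`Theorems/CircuitCircuitNpTc0Dictionary.lean`):

* values and depths of earlier gates are stable under appending gates
  (`dict_getD_gateValues_append`, `dict_getD_gateWDepths_append`); a block of gates referring only
  to earlier gates evaluates against the earlier values (`dict_getD_gateValues_append_indep`,
  `dict_getD_gateWDepths_append_indep`, from the layer lemmas `DepthReduction.gateValues_layer` /
  `gateWDepths_layer` of `DepthReductionProofs.lean`);
* three of the four blocks appended behind a gate list `ags` whose inputs are operands `U a`
  carrying, on every Boolean input `x : α`, the bit `f a x` (as `0/1` under
  `MvPolynomial.eval (pt x)`) at product-depth `≤ D`: `¬ u ↦ 1 − u` (`dict_block_not`: 2 edges,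
  depth `D`), `∧ₖ ↦ ∏ uₐ` (`dict_block_and`: `k` edges), `∨ₖ ↦ 1 − ∏ (1 − uₐ)` (`dict_block_or`:
  `3k + 2` edges, `∨₀ = ∑ ∅`), each with `≤ 6k` edges and product-depth `≤ D + 1`. The `MAJₖ`
  block and the induction along the gate list are in the main file.

Theorems only; sorry-free.
-/

-- `Summit.<Summit>.<Problem>`: for the single-conjunct summit `PneNP` the duplicate `PneNP.PneNP` is mandated (D-0017).
set_option linter.dupNamespace false

namespace Summit.PneNP.PneNP.Cruxes.CircuitNpTc0.Sketch

open Literature.Computability.Complexity Literature.Computability.AlgebraicComplexity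
open Finset
open ArithCircuit hiding Gate

/-! ## Straight-line arithmetic gate lists: stability and independent blocks -/

section ArithGateLists

variable {R : Type*} {σ : Type*}

/-- Values of earlier gates are unchanged by appending gates. -/
theorem dict_getD_gateValues_append [CommSemiring R] (ags sfx : List (ArithCircuit.Gate R σ))
    {p : ℕ} (hp : p < ags.length) :
    (gateValues (ags ++ sfx)).getD p 0 = (gateValues ags).getD p 0 := by
  have h := gateValues_take_eq_take (ags ++ sfx) ags.length
  rw [List.take_left] at h
  rw [h, List.getD_eq_getElem?_getD, List.getD_eq_getElem?_getD, List.getElem?_take, if_pos hp]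

/-- Depths of earlier gates are unchanged by appending gates. -/
theorem dict_getD_gateWDepths_append (w : ArithCircuit.Gate R σ → ℕ)
    (ags sfx : List (ArithCircuit.Gate R σ)) {p : ℕ} (hp : p < ags.length) :
    (gateWDepths w (ags ++ sfx)).getD p 0 = (gateWDepths w ags).getD p 0 := by
  have h := gateWDepths_take_eq_take w (ags ++ sfx) ags.length
  rw [List.take_left] at h
  rw [h, List.getD_eq_getElem?_getD, List.getD_eq_getElem?_getD, List.getElem?_take, if_pos hp]

/-- **Value of a gate of an independent block**: if every gate of `sfx` refers only to gates of
`ags`, then gate `j` of `sfx`, placed behind `ags`, evaluates against the values of `ags`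
(`DepthReduction.gateValues_layer`). -/
theorem dict_getD_gateValues_append_indep [CommSemiring R] (ags sfx : List (ArithCircuit.Gate R σ))
    (h : ∀ g ∈ sfx, ∀ u ∈ g.args, u.RefsBelow ags.length) {j : ℕ} {g : ArithCircuit.Gate R σ}
    (hg : sfx[j]? = some g) :
    (gateValues (ags ++ sfx)).getD (ags.length + j) 0 = g.eval (gateValues ags) := by
  rw [DepthReduction.gateValues_layer ags sfx h, List.getD_eq_getElem?_getD,
    List.getElem?_append_right (by rw [gateValues_length]; omega), gateValues_length,
    Nat.add_sub_cancel_left, List.getElem?_map, hg]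
  rfl

/-- **Depth of a gate of an independent block** (`DepthReduction.gateWDepths_layer`). -/
theorem dict_getD_gateWDepths_append_indep (w : ArithCircuit.Gate R σ → ℕ)
    (ags sfx : List (ArithCircuit.Gate R σ))
    (h : ∀ g ∈ sfx, ∀ u ∈ g.args, u.RefsBelow ags.length) {j : ℕ} {g : ArithCircuit.Gate R σ}
    (hg : sfx[j]? = some g) :
    (gateWDepths w (ags ++ sfx)).getD (ags.length + j) 0 =
      w g + ((g.args.map (Operand.depthIn (gateWDepths w ags))).foldr max 0) := by
  rw [DepthReduction.gateWDepths_layer w ags sfx h, List.getD_eq_getElem?_getD,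
    List.getElem?_append_right (by rw [gateWDepths_length]; omega), gateWDepths_length,
    Nat.add_sub_cancel_left, List.getElem?_map, hg]
  rfl

/-- The value of the last gate of `ags ++ [g]`. -/
theorem dict_getD_gateValues_append_singleton [CommSemiring R] (ags : List (ArithCircuit.Gate R σ))
    (g : ArithCircuit.Gate R σ) :
    (gateValues (ags ++ [g])).getD ags.length 0 = g.eval (gateValues ags) := by
  rw [gateValues_append_singleton, List.getD_eq_getElem?_getD,
    List.getElem?_append_right (by rw [gateValues_length]), gateValues_length, Nat.sub_self]
  simp

/-- The depth of the last gate of `ags ++ [g]`. -/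
theorem dict_getD_gateWDepths_append_singleton (w : ArithCircuit.Gate R σ → ℕ)
    (ags : List (ArithCircuit.Gate R σ)) (g : ArithCircuit.Gate R σ) :
    (gateWDepths w (ags ++ [g])).getD ags.length 0 =
      w g + ((g.args.map (Operand.depthIn (gateWDepths w ags))).foldr max 0) := by
  rw [gateWDepths_append_singleton, List.getD_eq_getElem?_getD,
    List.getElem?_append_right (by rw [gateWDepths_length]), gateWDepths_length, Nat.sub_self]
  simp

/-! ### The shapes of gates used by the dictionary -/

variable [CommSemiring R]

/-- The affine gate `c · u + b · 1` evaluates to `c · u + b`. -/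
theorem dict_eval_affGate (pt : σ → R) (vals : List (MvPolynomial σ R)) (c b : R)
    (u : Operand R σ) :
    MvPolynomial.eval pt ((Gate.sum [(c, u), (b, .const 1)]).eval vals) =
      c * MvPolynomial.eval pt (u.eval vals) + b := by
  simp [Gate.eval, Operand.eval, MvPolynomial.smul_eval]

/-- The affine gate `c · u + b · 1` is a sum gate of the product-depth of `u`. -/
theorem dict_depth_affGate (ds : List ℕ) (c b : R) (u : Operand R σ) :
    prodWeight (Gate.sum [(c, u), (b, .const 1)]) +
      (((Gate.sum [(c, u), (b, .const 1)]).args.map (Operand.depthIn ds)).foldr max 0) =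
      u.depthIn ds := by
  simp [prodWeight, Gate.isProd, ArithCircuit.Gate.args, Operand.depthIn]

/-- The unit-weight sum gate `∑ₐ uₐ` evaluates to the sum of its operands. -/
theorem dict_eval_sumGate (pt : σ → R) (vals : List (MvPolynomial σ R)) {k : ℕ}
    (U : Fin k → Operand R σ) :
    MvPolynomial.eval pt ((Gate.sum (List.ofFn fun a => ((1 : R), U a))).eval vals) =
      ∑ a, MvPolynomial.eval pt ((U a).eval vals) := by
  simp [Gate.eval, List.map_ofFn, List.sum_ofFn, map_sum, Function.comp_def]

/-- The unit-weight sum gate has product-depth the maximum of its operands'. -/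
theorem dict_depth_sumGate_le (ds : List ℕ) {k : ℕ} (U : Fin k → Operand R σ) {B : ℕ}
    (h : ∀ a, (U a).depthIn ds ≤ B) :
    prodWeight (Gate.sum (List.ofFn fun a => ((1 : R), U a))) +
      (((Gate.sum (List.ofFn fun a => ((1 : R), U a))).args.map (Operand.depthIn ds)).foldr
        max 0) ≤ B := by
  simp only [prodWeight, Gate.isProd, ArithCircuit.Gate.args, Bool.false_eq_true, if_false,
    zero_add, List.map_ofFn]
  refine DepthReduction.foldr_max_le fun x hx => ?_
  obtain ⟨a, rfl⟩ := List.mem_ofFn.1 hx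
  exact h a

/-- The product gate `∏ₐ Vₐ` evaluates to the product of its operands. -/
theorem dict_eval_prodGate (pt : σ → R) (vals : List (MvPolynomial σ R)) {k : ℕ}
    (V : Fin k → Operand R σ) :
    MvPolynomial.eval pt ((Gate.prod (List.ofFn V)).eval vals) =
      ∏ a, MvPolynomial.eval pt ((V a).eval vals) := by
  simp [Gate.eval, List.map_ofFn, List.prod_ofFn, map_prod, Function.comp_def]

/-- The product gate `c · ∏ₐ Vₐ` (constant operand first) evaluates to `c` times the product. -/
theorem dict_eval_prodGate_const (pt : σ → R) (vals : List (MvPolynomial σ R)) (c : R) {k : ℕ}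
    (V : Fin k → Operand R σ) :
    MvPolynomial.eval pt ((Gate.prod (.const c :: List.ofFn V)).eval vals) =
      c * ∏ a, MvPolynomial.eval pt ((V a).eval vals) := by
  simp [Gate.eval, Operand.eval, List.map_ofFn, List.prod_ofFn, map_prod, Function.comp_def]

omit [CommSemiring R] in
/-- A product gate has product-depth one more than the maximum of its operands'. -/
theorem dict_depth_prodGate_le (ds : List ℕ) (args : List (Operand R σ)) {B : ℕ}
    (h : ∀ u ∈ args, u.depthIn ds ≤ B) :
    prodWeight (Gate.prod args) +
      (((Gate.prod args).args.map (Operand.depthIn ds)).foldr max 0) ≤ 1 + B := by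
  simp only [prodWeight, Gate.isProd, if_true, ArithCircuit.Gate.args]
  refine Nat.add_le_add_left (DepthReduction.foldr_max_le fun x hx => ?_) 1
  obtain ⟨u, hu, rfl⟩ := List.mem_map.1 hx
  exact h u hu

end ArithGateLists

/-! ## The four gate blocks of the dictionary

Each block is appended behind a gate list `ags`; its inputs are operands `U a` referring to gates
of `ags` (or to variables), carrying on every Boolean input `x : α` the bit `f a x` (as `0/1`
under the evaluation `MvPolynomial.eval (pt x)`) at product-depth `≤ D`. The block provides a
position `p` carrying the output bit, with the stated edge and product-depth budget. -/

section Blocks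

variable {R : Type*} [CommRing R] {σ α : Type*} (pt : α → σ → R)

/-- **`¬`-block**: one sum gate `1 − u` (`2` edges, product-depth of `u`). -/
theorem dict_block_not (ags : List (ArithCircuit.Gate R σ)) (u : Operand R σ) (f : α → Bool)
    (D : ℕ) (hval : ∀ x, MvPolynomial.eval (pt x) (u.eval (gateValues ags)) = if f x then 1 else 0)
    (hdep : u.depthIn (gateWDepths prodWeight ags) ≤ D) :
    ∃ (sfx : List (ArithCircuit.Gate R σ)) (p : ℕ), p < (ags ++ sfx).length ∧
      (sfx.map Gate.fanIn).sum ≤ 6 * 1 ∧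
      (∀ x, MvPolynomial.eval (pt x) ((gateValues (ags ++ sfx)).getD p 0) =
        if (!f x) then 1 else 0) ∧
      (gateWDepths prodWeight (ags ++ sfx)).getD p 0 ≤ D := by
  refine ⟨[.sum [(-1, u), (1, .const 1)]], ags.length, by simp,
    by simp [Gate.fanIn, ArithCircuit.Gate.args], fun x => ?_, ?_⟩
  · rw [dict_getD_gateValues_append_singleton, dict_eval_affGate, hval x]
    cases f x <;> simp
  · rw [dict_getD_gateWDepths_append_singleton, dict_depth_affGate]
    exact hdep

/-- **`∧ₖ`-block**: one product gate `∏ₐ uₐ` (`k` edges, product-depth `+ 1`). -/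
theorem dict_block_and {k : ℕ} (ags : List (ArithCircuit.Gate R σ)) (U : Fin k → Operand R σ)
    (f : Fin k → α → Bool) (D : ℕ)
    (hval : ∀ a x, MvPolynomial.eval (pt x) ((U a).eval (gateValues ags)) = if f a x then 1 else 0)
    (hdep : ∀ a, (U a).depthIn (gateWDepths prodWeight ags) ≤ D) :
    ∃ (sfx : List (ArithCircuit.Gate R σ)) (p : ℕ), p < (ags ++ sfx).length ∧
      (sfx.map Gate.fanIn).sum ≤ 6 * k ∧
      (∀ x, MvPolynomial.eval (pt x) ((gateValues (ags ++ sfx)).getD p 0) =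
        if (∀ a, f a x = true) then 1 else 0) ∧
      (gateWDepths prodWeight (ags ++ sfx)).getD p 0 ≤ 1 + D := by
  refine ⟨[.prod (List.ofFn U)], ags.length, by simp, ?_, fun x => ?_, ?_⟩
  · simp [Gate.fanIn, ArithCircuit.Gate.args]; omega
  · rw [dict_getD_gateValues_append_singleton, dict_eval_prodGate]
    simp_rw [hval]
    rw [Finset.prod_boole]
    simp
  · rw [dict_getD_gateWDepths_append_singleton]
    exact dict_depth_prodGate_le _ _ fun u hu => by
      obtain ⟨a, rfl⟩ := List.mem_ofFn.1 hu
      exact hdep a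

/-- **`∨ₖ`-block**: `1 − ∏ₐ (1 − uₐ)` (`k` sum gates, one product gate, one sum gate:
`3k + 2 ≤ 6k` edges for `k ≥ 1`, product-depth `+ 1`); `∨₀` is the empty sum gate. -/
theorem dict_block_or {k : ℕ} (ags : List (ArithCircuit.Gate R σ)) (U : Fin k → Operand R σ)
    (f : Fin k → α → Bool) (D : ℕ) (hU : ∀ a, (U a).RefsBelow ags.length)
    (hval : ∀ a x, MvPolynomial.eval (pt x) ((U a).eval (gateValues ags)) = if f a x then 1 else 0)
    (hdep : ∀ a, (U a).depthIn (gateWDepths prodWeight ags) ≤ D) :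
    ∃ (sfx : List (ArithCircuit.Gate R σ)) (p : ℕ), p < (ags ++ sfx).length ∧
      (sfx.map Gate.fanIn).sum ≤ 6 * k ∧
      (∀ x, MvPolynomial.eval (pt x) ((gateValues (ags ++ sfx)).getD p 0) =
        if (∃ a, f a x = true) then 1 else 0) ∧
      (gateWDepths prodWeight (ags ++ sfx)).getD p 0 ≤ 1 + D := by
  rcases Nat.eq_zero_or_pos k with rfl | hk
  · refine ⟨[.sum []], ags.length, by simp, by simp [Gate.fanIn, ArithCircuit.Gate.args],
      fun x => ?_, ?_⟩
    · rw [dict_getD_gateValues_append_singleton]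
      simp [Gate.eval]
    · rw [dict_getD_gateWDepths_append_singleton]
      simp [prodWeight, Gate.isProd, ArithCircuit.Gate.args]
  -- `k ≥ 1`: the negated inputs `N`, their product `P`, and `1 - P`
  set N : List (ArithCircuit.Gate R σ) :=
    List.ofFn fun a : Fin k => Gate.sum [(-1, U a), (1, .const 1)] with hN
  set P : ArithCircuit.Gate R σ := .prod (List.ofFn fun a : Fin k => .gate (ags.length + a)) with hP
  set Fg : ArithCircuit.Gate R σ := .sum [(-1, .gate (ags.length + k)), (1, .const 1)] with hFg
  have hNlen : N.length = k := by simp [hN]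
  have hNind : ∀ g ∈ N, ∀ u ∈ g.args, u.RefsBelow ags.length := by
    intro g hg u hu
    rw [hN, List.mem_ofFn] at hg
    obtain ⟨a, rfl⟩ := hg
    simp only [ArithCircuit.Gate.args, List.map_cons, List.map_nil, List.mem_cons, List.not_mem_nil,
      or_false] at hu
    rcases hu with rfl | rfl
    · exact hU a
    · trivial
  have hNget : ∀ a : Fin k, N[(a : ℕ)]? = some (.sum [(-1, U a), (1, .const 1)]) := fun a => by
    rw [hN, List.getElem?_ofFn]; simp [a.isLt]
  -- stage 1: the negated inputs
  have hNval : ∀ (a : Fin k) x, MvPolynomial.eval (pt x)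
      ((gateValues (ags ++ N)).getD (ags.length + a) 0) = if f a x then 0 else 1 := by
    intro a x
    rw [dict_getD_gateValues_append_indep ags N hNind (hNget a), dict_eval_affGate, hval]
    split <;> ring
  have hNdep : ∀ a : Fin k, (gateWDepths prodWeight (ags ++ N)).getD (ags.length + a) 0 ≤ D := by
    intro a
    rw [dict_getD_gateWDepths_append_indep _ ags N hNind (hNget a), dict_depth_affGate]
    exact hdep a
  -- stage 2: their product
  have hlen2 : (ags ++ N).length = ags.length + k := by simp [hNlen]
  have hPval : ∀ x, MvPolynomial.eval (pt x)
      ((gateValues (ags ++ N ++ [P])).getD (ags.length + k) 0) =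
        if (∃ a, f a x = true) then 0 else 1 := by
    intro x
    rw [← hlen2, dict_getD_gateValues_append_singleton, hP, dict_eval_prodGate]
    simp only [Operand.eval_gate]
    simp_rw [hNval]
    by_cases h : ∃ a, f a x = true
    · obtain ⟨a, ha⟩ := h
      rw [if_pos ⟨a, ha⟩]
      exact Finset.prod_eq_zero (Finset.mem_univ a) (by rw [if_pos ha])
    · rw [if_neg h]
      exact Finset.prod_eq_one fun a _ => by rw [if_neg fun ha => h ⟨a, ha⟩]
  have hPdep : (gateWDepths prodWeight (ags ++ N ++ [P])).getD (ags.length + k) 0 ≤ 1 + D := by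
    rw [← hlen2, dict_getD_gateWDepths_append_singleton, hP]
    refine dict_depth_prodGate_le _ _ fun u hu => ?_
    obtain ⟨a, rfl⟩ := List.mem_ofFn.1 hu
    exact hNdep a
  -- stage 3: one minus the product
  have hlen3 : (ags ++ N ++ [P]).length = ags.length + k + 1 := by
    simp only [List.length_append, List.length_singleton, hNlen]
  have hassoc : ags ++ (N ++ [P] ++ [Fg]) = ags ++ N ++ [P] ++ [Fg] := by
    simp only [List.append_assoc]
  refine ⟨N ++ [P] ++ [Fg], ags.length + k + 1, ?_, ?_, fun x => ?_, ?_⟩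
  · simp only [List.length_append, List.length_singleton, hNlen]; omega
  · have h1 : (N.map Gate.fanIn).sum = 2 * k := by
      rw [hN, List.map_ofFn, List.sum_ofFn]
      simp [Gate.fanIn, ArithCircuit.Gate.args, mul_comm]
    simp only [List.map_append, List.sum_append, h1, List.map_cons, List.map_nil, List.sum_cons,
      List.sum_nil, hP, hFg, Gate.fanIn, ArithCircuit.Gate.args, List.length_ofFn, List.length_cons,
      List.length_nil]
    omega
  · rw [hassoc, ← hlen3, dict_getD_gateValues_append_singleton, hFg, dict_eval_affGate,
      Operand.eval_gate, hPval x]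
    split <;> ring
  · rw [hassoc, ← hlen3, dict_getD_gateWDepths_append_singleton, hFg, dict_depth_affGate]
    exact hPdep

end Blocks

end Summit.PneNP.PneNP.Cruxes.CircuitNpTc0.Sketch
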